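import Summits.QuantumFields.YangMills.Theorems.TwistedTraceScaling.Negative.CoreWindowLedger
import HarnessLib

/-!
# R58 — the INTRINSIC (B-OD) FLOOR OF A FROZEN FIBRE PROFILE: a first-order tilt forces `b ≳ powScale s β` (tightness of lane A's hOD currency)

The record input `RecordBOInput` (`…TwistedTraceScalingRecordBricks`) takes a fibre profile `Ω : ℝ → LinkSpace L → ℝ` that does NOT depend on the slow point `u`
(a FROZEN profile: `boFun L φ (Ω β) = φ(slowMean ·)·Ω β(fluctuation ·)`), and asks in its field `hOD` that for EVERY bounded measurable slow amplitude `φ` supported in the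
window `orbitDist u < δ₁ β` and every `v` fibrewise `w`-orthogonal to `Ω β`,
`|tubeCross β (boFun φ Ω) v| ≤ b β·(σ β·λ₀)·‖boFun φ Ω‖_w·‖v‖_w` with a rate `b` satisfying `hb_small : ∀ a > 0, ∀ᶠ β, b β² ≤ a·λ_b(L³β)` (`λ_b(L³β) ≍ β^{-1/3}`).

THE TWO-LEVEL MECHANISM (this file, §1, pure algebra).  Fix a slow point `u` in the window and let `K` be the (symmetric) fibre form there, with top eigenpair `(Λ₀, Ω₀)`
(`Ω₀ = Ω_u`, the TRUE fibre ground state at background `u`), a unit vector `ν ⊥ Ω₀` with `K ν ν = Λν ≤ Λ₁ < Λ₀` and `K Ω₀ ν = 0`.  A frozen profile is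
`Ω = c•Ω₀ + s•ν` (`c = cos θ_u`, `s = sin θ_u`, the TILT of the frozen profile against the true one).  The rotated vector `ν' = (−s)•Ω₀ + c•ν` is a unit vector
ORTHOGONAL to `Ω`, hence an admissible `v` in `hOD` (take `φ` concentrated at `u`), and (★ `twoLevel_offDiag_eq`) `K Ω ν' = c·s·(Λν − Λ₀)`: the off-diagonal element
is of FIRST ORDER in the tilt.  Consequently (★★ `offDiag_floor_of_bound`) any bound `|K Ω v| ≤ b·M·‖Ω‖·‖v‖ ∀ v ⊥ Ω` forces `c·s·(Λ₀ − Λ₁) ≤ b·M`, i.e. with the stiff gap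
`Λ₀ − Λ₁ ≥ θ₀·M` of `hST` (`M = σ β·λ₀`): `b ≥ cos θ_u · sin θ_u · θ₀`.

THE SIZE OF THE TILT (§2–§4).  For Gaussian fibre profiles the overlap is explicit: `cos²θ = 2√(aa')/(a + a')` for widths `a, a'` (★ `gaussian_cosSq_eq`, from
`∫ e^{-ax²}e^{-a'x²} = √(π/(a+a'))`), with `(a − a')²/(2(a + a')²) ≤ 1 − cos²θ ≤ (a − a')²/(a + a')²` (★ `one_sub_gaussian_cosSq_bounds`): the tilt is FIRST ORDER in the
relative width change, and for a product state the deficit is at least the worst single-mode deficit (`one_sub_prod_ge`).  The widths of the stiff Gaussian are functions of the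
stiff frequencies `μ_i(u)` (as read from `stiffGaussExp`: `c_i = (β/2)√(μ_i² + 4μ_i)`, so `δc_i/c_i = (μ_i + 2)/(μ_i(μ_i + 4))·δμ_i`), and in the linearised model of the
stiff Hessian (free covariant Laplacian in a constant toron background `u = exp(a·T₃)`, charged components see momenta `p ± a`) the frequencies `4 sin²((p ± a)/2) = 2 − 2cos(p ± a)`
move at FIRST ORDER with coefficient `2 sin p` (★ `dispersion_hasDerivAt`).  For `L = 2` every nonzero momentum is `p = π` and `2 sin π = 0` (`firstOrder_shift_L2`: NO first-order
tilt; the floor from this mechanism is only `O(β^{-2s})`); for `L ≥ 3` the momentum `p = 2π/L` has `2 sin p > 0` (`firstOrder_shift_pos`; `L = 3`: `2 sin(2π/3) = √3`,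
`firstOrder_shift_L3`).  Numerics (pure python, degenerate perturbation theory of the linearised stiff Hessian, this seat g46, files `num/fibre_shift2_L{2,3}.out`): `L = 2`
clusters `μ ∈ {4, 8, 12}` (multiplicities 18/18/6), all first-order shifts `0`; `L = 3` clusters `μ ∈ {3, 6, 9}` (36/72/48), shifts `∈ {±√3·a, 0}` in every cluster — exactly
`±2 sin(2π/3)·a`.  So for `L ≥ 3` a slow point at the edge of the window `orbitDist u ≍ δ₁ β = 14·powScale s β/|Site|` tilts the frozen profile by `sin θ_u ≥ A_L·powScale s β`.

THE LEDGER CONSEQUENCE (§5).  ★★ `frozenProfile_offDiag_floor_eventually`: tilt `s β ≥ A·powScale r β`, overlap `c β ≥ c₀`, relative gap `g` ⇒ `c₀·g·A·powScale r β ≤ b β`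
eventually; ★★★ `frozenProfile_not_hb_small`: with `r ≤ 1/6` this sinks `hb_small` (R54 `not_hb_small_of_powScale_floor`); `firstOrder_floor_affordable`: for `r > 1/6` the same
floor is affordable.  READING: from the (B-OD) side ALONE a frozen profile pins the slow window exponent at `s > 1/6` for `L ≥ 3` — the same threshold that (B-T)'s `hκ_dom`
(`κ ≥ C(Kβ^{-s})²`, `hκ_small`) and the (C4) core ledger (R54/R54B) give; lane A's currency `b_core ≥ √8·E`, `E = Õ(β^{-s})` (R54B/R57 `currency_ge_exponent`) is therefore TIGHT up to
polylogs: no (C5) estimate can make `b = o(β^{-s})` for a frozen profile on the full window, and going below `s = 1/6` would need an ADIABATIC profile `Ω_u` (not expressible in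
`RecordBOInput`, whose `Ω` has no slow argument).

HONEST FRAMING: tightness / side-condition bookkeeping for a stub (`TwistedTraceScaling`, stmt-QuantumFields-20203) of a child of a CONDITIONAL reduction route (R2b1); nothing
landed is refuted — lane A works in `1/6 < s < 1/5` where the floor is affordable (`firstOrder_floor_affordable`); the identification of `K`, `M`, `g`, `A` with the record's
fibre form is the informal dictionary above, not a landed theorem; (C5), the hOD assembly, (B-ST) remain OPEN; not infinite volume, not a mass gap, not Clay.
-/

set_option autoImplicit false

noncomputable section

open Real Filter Topology MeasureTheory
open scoped RealInnerProductSpace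
open Summit.QuantumFields.YangMills.Theorems.FemtoTransferGap
open Summit.QuantumFields.YangMills.Theorems.FemtoTransferGap.TwoLattice
open Summit.QuantumFields.YangMills.Theorems.TwistedTraceScaling.Negative

namespace Summit.QuantumFields.YangMills.Theorems.TwistedTraceScaling.Negative.R58

/-! ## §1 Two-level algebra: a frozen profile tilted against the top eigenvector has an off-diagonal element of first order in the tilt -/

section TwoLevel

variable {E : Type*} [NormedAddCommGroup E] [InnerProductSpace ℝ E]

/-- ★ For a bilinear form `K` with `K Ω₀ Ω₀ = Λ₀`, `K Ω₀ ν = K ν Ω₀ = 0`, `K ν ν = Λν`, the frozen profile `Ω = c•Ω₀ + s•ν` and the rotated vector `ν' = (−s)•Ω₀ + c•ν`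
have `K Ω ν' = c·s·(Λν − Λ₀)` — first order in the tilt `s`. [folklore] -/
theorem twoLevel_offDiag_eq (K : E →ₗ[ℝ] E →ₗ[ℝ] ℝ) (Ω₀ ν : E) {Λ₀ Λν : ℝ} (c s : ℝ)
    (h00 : K Ω₀ Ω₀ = Λ₀) (h0ν : K Ω₀ ν = 0) (hν0 : K ν Ω₀ = 0) (hνν : K ν ν = Λν) :
    K (c • Ω₀ + s • ν) ((-s) • Ω₀ + c • ν) = c * s * (Λν - Λ₀) := by
  simp only [map_add, map_smul, LinearMap.add_apply, LinearMap.smul_apply, smul_eq_mul, h00, h0ν, hν0, hνν]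
  ring

/-- The first-order off-diagonal element dominates `c·s·(Λ₀ − Λ₁)` whenever `Λν ≤ Λ₁` (`c, s ≥ 0`). [folklore] -/
theorem twoLevel_offDiag_abs_ge (K : E →ₗ[ℝ] E →ₗ[ℝ] ℝ) (Ω₀ ν : E) {Λ₀ Λ₁ Λν c s : ℝ} (hc : 0 ≤ c) (hs : 0 ≤ s)
    (h00 : K Ω₀ Ω₀ = Λ₀) (h0ν : K Ω₀ ν = 0) (hν0 : K ν Ω₀ = 0) (hνν : K ν ν = Λν) (hΛ : Λν ≤ Λ₁) :
    c * s * (Λ₀ - Λ₁) ≤ |K (c • Ω₀ + s • ν) ((-s) • Ω₀ + c • ν)| := by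
  rw [twoLevel_offDiag_eq K Ω₀ ν c s h00 h0ν hν0 hνν]
  calc c * s * (Λ₀ - Λ₁) ≤ c * s * (Λ₀ - Λν) := mul_le_mul_of_nonneg_left (by linarith) (mul_nonneg hc hs)
    _ = -(c * s * (Λν - Λ₀)) := by ring
    _ ≤ |c * s * (Λν - Λ₀)| := neg_le_abs _

/-- The rotated pair is orthonormal: `‖c•Ω₀ + s•ν‖ = ‖(−s)•Ω₀ + c•ν‖ = 1` and `⟪c•Ω₀ + s•ν, (−s)•Ω₀ + c•ν⟫ = 0` for orthonormal `Ω₀, ν` and `c² + s² = 1`; in particular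
`ν'` is an ADMISSIBLE test vector for an off-diagonal bound quantified over `v ⊥ Ω`. [folklore] -/
theorem rotated_pair_orthonormal {Ω₀ ν : E} {c s : ℝ} (hΩ₀ : ‖Ω₀‖ = 1) (hν : ‖ν‖ = 1) (horth : ⟪Ω₀, ν⟫ = 0) (hcs : c ^ 2 + s ^ 2 = 1) :
    ‖c • Ω₀ + s • ν‖ = 1 ∧ ‖(-s) • Ω₀ + c • ν‖ = 1 ∧ ⟪c • Ω₀ + s • ν, (-s) • Ω₀ + c • ν⟫ = 0 := by
  have hΩ₀2 : ⟪Ω₀, Ω₀⟫ = 1 := by rw [real_inner_self_eq_norm_sq, hΩ₀]; norm_num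
  have hν2 : ⟪ν, ν⟫ = 1 := by rw [real_inner_self_eq_norm_sq, hν]; norm_num
  have horth' : ⟪ν, Ω₀⟫ = 0 := by rw [real_inner_comm]; exact horth
  have h1 : ⟪c • Ω₀ + s • ν, c • Ω₀ + s • ν⟫ = 1 := by
    simp only [inner_add_left, inner_add_right, real_inner_smul_left, real_inner_smul_right, hΩ₀2, hν2, horth, horth']
    linear_combination hcs
  have h2 : ⟪(-s) • Ω₀ + c • ν, (-s) • Ω₀ + c • ν⟫ = 1 := by
    simp only [inner_add_left, inner_add_right, real_inner_smul_left, real_inner_smul_right, hΩ₀2, hν2, horth, horth']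
    linear_combination hcs
  have h3 : ⟪c • Ω₀ + s • ν, (-s) • Ω₀ + c • ν⟫ = 0 := by
    simp only [inner_add_left, inner_add_right, real_inner_smul_left, real_inner_smul_right, hΩ₀2, hν2, horth, horth']
    ring
  refine ⟨?_, ?_, h3⟩
  · rw [norm_eq_sqrt_real_inner, h1, Real.sqrt_one]
  · rw [norm_eq_sqrt_real_inner, h2, Real.sqrt_one]

/-- ★★ **THE FROZEN-PROFILE FLOOR.**  If the off-diagonal bound `|K Ω v| ≤ b·M·‖Ω‖·‖v‖` holds for every `v ⊥ Ω = c•Ω₀ + s•ν` (orthonormal `Ω₀ ⊥ ν`, `c² + s² = 1`,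
`c, s ≥ 0`, two-level data as above with `Λν ≤ Λ₁`), then `c·s·(Λ₀ − Λ₁) ≤ b·M`: the rate `b` is at least (tilt) × (overlap) × (gap/M). [folklore] -/
theorem offDiag_floor_of_bound (K : E →ₗ[ℝ] E →ₗ[ℝ] ℝ) {Ω₀ ν : E} {Λ₀ Λ₁ Λν c s b M : ℝ} (hc : 0 ≤ c) (hs : 0 ≤ s)
    (hΩ₀ : ‖Ω₀‖ = 1) (hν : ‖ν‖ = 1) (horth : ⟪Ω₀, ν⟫ = 0) (hcs : c ^ 2 + s ^ 2 = 1)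
    (h00 : K Ω₀ Ω₀ = Λ₀) (h0ν : K Ω₀ ν = 0) (hν0 : K ν Ω₀ = 0) (hνν : K ν ν = Λν) (hΛ : Λν ≤ Λ₁)
    (hOD : ∀ v : E, ⟪c • Ω₀ + s • ν, v⟫ = 0 → |K (c • Ω₀ + s • ν) v| ≤ b * M * ‖c • Ω₀ + s • ν‖ * ‖v‖) :
    c * s * (Λ₀ - Λ₁) ≤ b * M := by
  obtain ⟨h1, h2, h3⟩ := rotated_pair_orthonormal hΩ₀ hν horth hcs
  have h := hOD _ h3
  rw [h1, h2, mul_one, mul_one] at h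
  exact (twoLevel_offDiag_abs_ge K Ω₀ ν hc hs h00 h0ν hν0 hνν hΛ).trans h

/-- An overlap deficit `c² ≤ 1 − d` means a tilt `s ≥ √d` (`c² + s² = 1`, `s ≥ 0`). [folklore] -/
theorem sqrt_deficit_le_tilt {c s d : ℝ} (hs : 0 ≤ s) (hcs : c ^ 2 + s ^ 2 = 1) (hd : c ^ 2 ≤ 1 - d) : Real.sqrt d ≤ s := by
  have : d ≤ s ^ 2 := by linarith
  calc Real.sqrt d ≤ Real.sqrt (s ^ 2) := Real.sqrt_le_sqrt this
    _ = s := Real.sqrt_sq hs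

/-- ★★ Deficit form of the floor: an overlap deficit `cos²θ ≤ 1 − d` of the frozen profile against the true top state forces `c·√d·(Λ₀ − Λ₁) ≤ b·M`. [folklore] -/
theorem offDiag_floor_of_deficit (K : E →ₗ[ℝ] E →ₗ[ℝ] ℝ) {Ω₀ ν : E} {Λ₀ Λ₁ Λν c s b M d : ℝ} (hc : 0 ≤ c) (hs : 0 ≤ s)
    (hΩ₀ : ‖Ω₀‖ = 1) (hν : ‖ν‖ = 1) (horth : ⟪Ω₀, ν⟫ = 0) (hcs : c ^ 2 + s ^ 2 = 1)
    (h00 : K Ω₀ Ω₀ = Λ₀) (h0ν : K Ω₀ ν = 0) (hν0 : K ν Ω₀ = 0) (hνν : K ν ν = Λν) (hΛ : Λν ≤ Λ₁) (hgap : Λ₁ ≤ Λ₀) (hd : c ^ 2 ≤ 1 - d)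
    (hOD : ∀ v : E, ⟪c • Ω₀ + s • ν, v⟫ = 0 → |K (c • Ω₀ + s • ν) v| ≤ b * M * ‖c • Ω₀ + s • ν‖ * ‖v‖) :
    c * Real.sqrt d * (Λ₀ - Λ₁) ≤ b * M := by
  have hsd := sqrt_deficit_le_tilt hs hcs hd
  calc c * Real.sqrt d * (Λ₀ - Λ₁) ≤ c * s * (Λ₀ - Λ₁) :=
        mul_le_mul_of_nonneg_right (mul_le_mul_of_nonneg_left hsd hc) (by linarith)
    _ ≤ b * M := offDiag_floor_of_bound K hc hs hΩ₀ hν horth hcs h00 h0ν hν0 hνν hΛ hOD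

end TwoLevel

/-! ## §2 Gaussian fibre profiles: the overlap of two centred Gaussians and the size of the tilt -/

/-- `∫ e^{-a x²}·e^{-a' x²} dx = √(π/(a + a'))`. [folklore] -/
theorem integral_gaussian_mul (a a' : ℝ) :
    ∫ x : ℝ, Real.exp (-a * x ^ 2) * Real.exp (-a' * x ^ 2) = Real.sqrt (π / (a + a')) := by
  have h : ∀ x : ℝ, Real.exp (-a * x ^ 2) * Real.exp (-a' * x ^ 2) = Real.exp (-(a + a') * x ^ 2) := by
    intro x; rw [← Real.exp_add]; congr 1; ring
  simp_rw [h]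
  exact integral_gaussian (a + a')

/-- `∫ (e^{-a x²})² dx = √(π/(2a))`. [folklore] -/
theorem integral_gaussian_sq (a : ℝ) : ∫ x : ℝ, Real.exp (-a * x ^ 2) ^ 2 = Real.sqrt (π / (2 * a)) := by
  have h : ∀ x : ℝ, Real.exp (-a * x ^ 2) ^ 2 = Real.exp (-a * x ^ 2) * Real.exp (-a * x ^ 2) := fun x => sq _
  simp_rw [h]
  rw [integral_gaussian_mul, show a + a = 2 * a by ring]

/-- `√(π/(2a))·√(π/(2a')) = π/(2√(aa'))` for `a, a' > 0`. [folklore] -/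
theorem sqrt_pi_div_mul {a a' : ℝ} (ha : 0 < a) (ha' : 0 < a') :
    Real.sqrt (π / (2 * a)) * Real.sqrt (π / (2 * a')) = π / (2 * Real.sqrt (a * a')) := by
  have hπ := Real.pi_pos
  have hs : 0 < Real.sqrt (a * a') := Real.sqrt_pos.mpr (mul_pos ha ha')
  rw [← Real.sqrt_mul (show (0 : ℝ) ≤ π / (2 * a) by positivity)]
  have : π / (2 * a) * (π / (2 * a')) = (π / (2 * Real.sqrt (a * a'))) ^ 2 := by
    rw [div_pow, mul_pow, Real.sq_sqrt (by positivity : (0 : ℝ) ≤ a * a')]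
    field_simp
  rw [this, Real.sqrt_sq (show (0 : ℝ) ≤ π / (2 * Real.sqrt (a * a')) by positivity)]

/-- ★ The squared overlap (`cos²θ`) of the centred Gaussians `e^{-a x²}`, `e^{-a' x²}` (`a, a' > 0`) is `2√(aa')/(a + a')`. [folklore] -/
theorem gaussian_cosSq_eq {a a' : ℝ} (ha : 0 < a) (ha' : 0 < a') :
    (∫ x : ℝ, Real.exp (-a * x ^ 2) * Real.exp (-a' * x ^ 2)) ^ 2 /
        ((∫ x : ℝ, Real.exp (-a * x ^ 2) ^ 2) * ∫ x : ℝ, Real.exp (-a' * x ^ 2) ^ 2) =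
      2 * Real.sqrt (a * a') / (a + a') := by
  have hπ := Real.pi_pos
  have hs : 0 < Real.sqrt (a * a') := Real.sqrt_pos.mpr (mul_pos ha ha')
  rw [integral_gaussian_mul, integral_gaussian_sq, integral_gaussian_sq, Real.sq_sqrt (show (0 : ℝ) ≤ π / (a + a') by positivity),
    sqrt_pi_div_mul ha ha']
  field_simp

/-- The tilt bounds in the variables `p = √a`, `q = √a'`: `(p² − q²)²/(2(p² + q²)²) ≤ 1 − 2pq/(p² + q²) ≤ (p² − q²)²/(p² + q²)²` (`1 − 2pq/(p² + q²) = (p − q)²/(p² + q²)`,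
`(p² − q²)² = (p − q)²(p + q)²`, `p² + q² ≤ (p + q)² ≤ 2(p² + q²)`). [folklore] -/
theorem cosSq_aux {p q : ℝ} (hp : 0 < p) (hq : 0 < q) :
    (p ^ 2 - q ^ 2) ^ 2 / (2 * (p ^ 2 + q ^ 2) ^ 2) ≤ 1 - 2 * (p * q) / (p ^ 2 + q ^ 2) ∧
      1 - 2 * (p * q) / (p ^ 2 + q ^ 2) ≤ (p ^ 2 - q ^ 2) ^ 2 / (p ^ 2 + q ^ 2) ^ 2 := by
  have hpq : 0 < p ^ 2 + q ^ 2 := by positivity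
  have key : 1 - 2 * (p * q) / (p ^ 2 + q ^ 2) = (p - q) ^ 2 / (p ^ 2 + q ^ 2) := by
    field_simp
    ring
  have fac : (p ^ 2 - q ^ 2) ^ 2 = (p - q) ^ 2 * (p + q) ^ 2 := by ring
  rw [key, fac]
  have h0 : 0 ≤ (p - q) ^ 2 * (p ^ 2 + q ^ 2) := by positivity
  constructor
  · rw [div_le_div_iff₀ (by positivity) hpq]
    have h1 : (p + q) ^ 2 ≤ 2 * (p ^ 2 + q ^ 2) := by nlinarith [sq_nonneg (p - q)]
    calc (p - q) ^ 2 * (p + q) ^ 2 * (p ^ 2 + q ^ 2) = (p - q) ^ 2 * (p ^ 2 + q ^ 2) * (p + q) ^ 2 := by ring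
      _ ≤ (p - q) ^ 2 * (p ^ 2 + q ^ 2) * (2 * (p ^ 2 + q ^ 2)) := mul_le_mul_of_nonneg_left h1 h0
      _ = (p - q) ^ 2 * (2 * (p ^ 2 + q ^ 2) ^ 2) := by ring
  · rw [div_le_div_iff₀ hpq (by positivity)]
    have h1 : p ^ 2 + q ^ 2 ≤ (p + q) ^ 2 := by nlinarith [mul_pos hp hq]
    calc (p - q) ^ 2 * (p ^ 2 + q ^ 2) ^ 2 = (p - q) ^ 2 * (p ^ 2 + q ^ 2) * (p ^ 2 + q ^ 2) := by ring
      _ ≤ (p - q) ^ 2 * (p ^ 2 + q ^ 2) * (p + q) ^ 2 := mul_le_mul_of_nonneg_left h1 h0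
      _ = (p - q) ^ 2 * (p + q) ^ 2 * (p ^ 2 + q ^ 2) := by ring

/-- ★ **The tilt is first order in the relative width change**: for `a, a' > 0`,
`(a − a')²/(2(a + a')²) ≤ 1 − 2√(aa')/(a + a') ≤ (a − a')²/(a + a')²`; e.g. `a' = a(1 + ε)`: `ε²/(2(2 + ε)²) ≤ sin²θ ≤ ε²/(2 + ε)²`. [folklore] -/
theorem one_sub_gaussian_cosSq_bounds {a a' : ℝ} (ha : 0 < a) (ha' : 0 < a') :
    (a - a') ^ 2 / (2 * (a + a') ^ 2) ≤ 1 - 2 * Real.sqrt (a * a') / (a + a') ∧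
      1 - 2 * Real.sqrt (a * a') / (a + a') ≤ (a - a') ^ 2 / (a + a') ^ 2 := by
  have h := cosSq_aux (Real.sqrt_pos.mpr ha) (Real.sqrt_pos.mpr ha')
  rw [Real.sq_sqrt ha.le, Real.sq_sqrt ha'.le, ← Real.sqrt_mul ha.le] at h
  exact h

/-! ## §3 Product states: the multimode overlap deficit dominates the worst single-mode deficit -/

/-- `∏_{i ∈ S} t i ≤ t j` for `j ∈ S` and factors `t i ∈ [0, 1]` (overlaps of product Gaussians multiply). [folklore] -/
theorem prod_le_factor {ι : Type*} (S : Finset ι) (t : ι → ℝ) (h0 : ∀ i ∈ S, 0 ≤ t i) (h1 : ∀ i ∈ S, t i ≤ 1) {j : ι} (hj : j ∈ S) :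
    ∏ i ∈ S, t i ≤ t j := by
  classical
  rw [← Finset.mul_prod_erase S t hj]
  have hP1 : ∏ i ∈ S.erase j, t i ≤ 1 :=
    Finset.prod_le_one (fun i hi => h0 i (Finset.mem_of_mem_erase hi)) (fun i hi => h1 i (Finset.mem_of_mem_erase hi))
  calc t j * ∏ i ∈ S.erase j, t i ≤ t j * 1 := mul_le_mul_of_nonneg_left hP1 (h0 j hj)
    _ = t j := mul_one _

/-- `1 − t j ≤ 1 − ∏_{i ∈ S} t i`: the overlap deficit of a product state is at least the deficit of any single mode. [folklore] -/
theorem one_sub_prod_ge {ι : Type*} (S : Finset ι) (t : ι → ℝ) (h0 : ∀ i ∈ S, 0 ≤ t i) (h1 : ∀ i ∈ S, t i ≤ 1) {j : ι} (hj : j ∈ S) :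
    1 - t j ≤ 1 - ∏ i ∈ S, t i := by
  linarith [prod_le_factor S t h0 h1 hj]

/-! ## §4 The linearised stiff dispersion moves at first order in a toron background iff `2 sin p ≠ 0` (`L = 2`: no; `L ≥ 3`: yes) -/

/-- ★ The dispersion `a ↦ 2 − 2cos(p + a)` (`= 4 sin²((p + a)/2)`, the landed `…BalabanUV.Beta.GAN24.SymbolTaylor.four_sin_sq_half_eq`; a charged stiff mode of momentum `p` in the constant background `exp(a·T₃)`) has derivative `2 sin p` at
`a = 0`: the stiff frequencies shift at FIRST order unless `sin p = 0`. [folklore] -/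
theorem dispersion_hasDerivAt (p : ℝ) : HasDerivAt (fun a : ℝ => 2 - 2 * Real.cos (p + a)) (2 * Real.sin p) 0 := by
  have h1 : HasDerivAt (fun a : ℝ => p + a) 1 0 := (hasDerivAt_id' (0 : ℝ)).const_add p
  have h2 := ((h1.cos).const_mul 2).const_sub 2
  exact h2.congr_deriv (by simp)

/-- `L = 2`: the only momenta are `0` and `π`, and `2 sin 0 = 2 sin π = 0` — NO first-order shift (numerics: clusters `μ ∈ {4, 8, 12}`, all shifts `0`). [folklore] -/
theorem firstOrder_shift_L2 : 2 * Real.sin 0 = 0 ∧ 2 * Real.sin π = 0 := by simp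

/-- `L = 3`: the momentum `2π/3` has `2 sin(2π/3) = √3` (numerics: clusters `μ ∈ {3, 6, 9}`, shifts `±√3·a, 0`). [folklore] -/
theorem firstOrder_shift_L3 : 2 * Real.sin (2 * π / 3) = Real.sqrt 3 := by
  rw [show 2 * π / 3 = π - π / 3 by ring, Real.sin_pi_sub, Real.sin_pi_div_three]
  ring

/-- `L ≥ 3`: the lowest nonzero momentum `2π/L ∈ (0, π)` has `2 sin(2π/L) > 0` — a first-order shift is present for every `L ≥ 3`. [folklore] -/
theorem firstOrder_shift_pos {L : ℕ} (hL : 3 ≤ L) : 0 < 2 * Real.sin (2 * π / L) := by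
  have hL' : (3 : ℝ) ≤ (L : ℝ) := by exact_mod_cast hL
  have hπ := Real.pi_pos
  have h1 : 0 < 2 * π / L := by positivity
  have h2 : 2 * π / L < π := by
    rw [div_lt_iff₀ (by linarith)]
    nlinarith
  have := Real.sin_pos_of_pos_of_lt_pi h1 h2
  linarith

/-! ## §5 ★★★ The ledger consequence: a frozen profile with a first-order tilt has `b ≳ powScale r β`; `r ≤ 1/6` sinks `hb_small`, `r > 1/6` is affordable -/

section Ledger

variable {L : ℕ} [NeZero L]

/-- ★★ **FROZEN-PROFILE (B-OD) FLOOR, family form.**  A `β`-family of two-level data (fibre form `K β`, true top state `Ω₀ β ⊥ ν β` orthonormal, frozen profile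
`c β•Ω₀ β + s β•ν β` with `c² + s² = 1`, `c, s ≥ 0`, `K ν ν = Λν ≤ Λ₁`), an off-diagonal scale `M β > 0` with relative gap `g·M β ≤ Λ₀ β − Λ₁ β`, a first-order tilt
`A·powScale r β ≤ s β`, an overlap `c₀ ≤ c β`, and the (B-OD)-type bound `|K Ω v| ≤ b β·M β·‖Ω‖·‖v‖ ∀ v ⊥ Ω` (all eventually) force `c₀·g·A·powScale r β ≤ b β` eventually.
Dictionary (informal): `K β = tubeCross β` on the fibre at a slow point `u` at the edge of the window, `M β = σ β·λ₀`, `g = θ₀` of `hST`, `r = s` (the window exponent),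
`A = A_L > 0` for `L ≥ 3` (§4). [folklore] -/
theorem frozenProfile_offDiag_floor_eventually {E : Type*} [NormedAddCommGroup E] [InnerProductSpace ℝ E]
    (K : ℝ → E →ₗ[ℝ] E →ₗ[ℝ] ℝ) (Ω₀ ν : ℝ → E) (Λ₀ Λ₁ Λν c s b M : ℝ → ℝ) {g A c₀ r : ℝ} (hg : 0 < g) (hA : 0 < A)
    (hon : ∀ β, ‖Ω₀ β‖ = 1 ∧ ‖ν β‖ = 1 ∧ ⟪Ω₀ β, ν β⟫ = 0) (hcs : ∀ β, c β ^ 2 + s β ^ 2 = 1) (hc : ∀ β, 0 ≤ c β) (hs : ∀ β, 0 ≤ s β)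
    (hK : ∀ β, K β (Ω₀ β) (Ω₀ β) = Λ₀ β ∧ K β (Ω₀ β) (ν β) = 0 ∧ K β (ν β) (Ω₀ β) = 0 ∧ K β (ν β) (ν β) = Λν β) (hΛ : ∀ β, Λν β ≤ Λ₁ β)
    (hM : ∀ᶠ β in atTop, 0 < M β) (hgap : ∀ᶠ β in atTop, g * M β ≤ Λ₀ β - Λ₁ β)
    (htilt : ∀ᶠ β in atTop, A * powScale r β ≤ s β) (hcfl : ∀ᶠ β in atTop, c₀ ≤ c β)
    (hOD : ∀ᶠ β in atTop, ∀ v : E, ⟪c β • Ω₀ β + s β • ν β, v⟫ = 0 →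
      |K β (c β • Ω₀ β + s β • ν β) v| ≤ b β * M β * ‖c β • Ω₀ β + s β • ν β‖ * ‖v‖) :
    ∀ᶠ β in atTop, c₀ * g * A * powScale r β ≤ b β := by
  filter_upwards [hM, hgap, htilt, hcfl, hOD] with β hMβ hgapβ htβ hcβ hODβ
  obtain ⟨h1, h2, h3⟩ := hon β
  obtain ⟨k1, k2, k3, k4⟩ := hK β
  have hfloor := offDiag_floor_of_bound (K β) (hc β) (hs β) h1 h2 h3 (hcs β) k1 k2 k3 k4 (hΛ β) hODβ
  have hcs0 : 0 ≤ c β * s β := mul_nonneg (hc β) (hs β)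
  have h4 : c β * s β * g * M β ≤ b β * M β := by
    calc c β * s β * g * M β = c β * s β * (g * M β) := by ring
      _ ≤ c β * s β * (Λ₀ β - Λ₁ β) := mul_le_mul_of_nonneg_left hgapβ hcs0
      _ ≤ b β * M β := hfloor
  have h5 : c β * s β * g ≤ b β := le_of_mul_le_mul_right h4 hMβ
  have hAp : 0 ≤ A * powScale r β := mul_nonneg hA.le (powScale_pos _ _).le
  calc c₀ * g * A * powScale r β = c₀ * (A * powScale r β) * g := by ring
    _ ≤ c β * s β * g := mul_le_mul_of_nonneg_right (mul_le_mul hcβ htβ hAp (hc β)) hg.le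
    _ ≤ b β := h5

/-- ★★★ **ENDPOINT: a frozen profile with a first-order tilt of exponent `r ≤ 1/6` is NOT `hb_small`.**  Under the hypotheses of
`frozenProfile_offDiag_floor_eventually` with `r ≤ 1/6`: `¬ ∀ a > 0, ∀ᶠ β, b β² ≤ a·λ_b(L³β)` (R54 `not_hb_small_of_powScale_floor`).  With `r = s` the window exponent
(§4: the tilt at the window edge is `≍ powScale s β` for `L ≥ 3`), the (B-OD) field of a frozen profile pins `s > 1/6` on its own. [folklore] -/
theorem frozenProfile_not_hb_small {E : Type*} [NormedAddCommGroup E] [InnerProductSpace ℝ E]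
    (K : ℝ → E →ₗ[ℝ] E →ₗ[ℝ] ℝ) (Ω₀ ν : ℝ → E) (Λ₀ Λ₁ Λν c s b M : ℝ → ℝ) {g A c₀ r : ℝ} (hg : 0 < g) (hA : 0 < A) (hc₀ : 0 < c₀) (hr : r ≤ 1 / 6)
    (hon : ∀ β, ‖Ω₀ β‖ = 1 ∧ ‖ν β‖ = 1 ∧ ⟪Ω₀ β, ν β⟫ = 0) (hcs : ∀ β, c β ^ 2 + s β ^ 2 = 1) (hc : ∀ β, 0 ≤ c β) (hs : ∀ β, 0 ≤ s β)
    (hK : ∀ β, K β (Ω₀ β) (Ω₀ β) = Λ₀ β ∧ K β (Ω₀ β) (ν β) = 0 ∧ K β (ν β) (Ω₀ β) = 0 ∧ K β (ν β) (ν β) = Λν β) (hΛ : ∀ β, Λν β ≤ Λ₁ β)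
    (hM : ∀ᶠ β in atTop, 0 < M β) (hgap : ∀ᶠ β in atTop, g * M β ≤ Λ₀ β - Λ₁ β)
    (htilt : ∀ᶠ β in atTop, A * powScale r β ≤ s β) (hcfl : ∀ᶠ β in atTop, c₀ ≤ c β)
    (hOD : ∀ᶠ β in atTop, ∀ v : E, ⟪c β • Ω₀ β + s β • ν β, v⟫ = 0 →
      |K β (c β • Ω₀ β + s β • ν β) v| ≤ b β * M β * ‖c β • Ω₀ β + s β • ν β‖ * ‖v‖) :
    ¬ ∀ a : ℝ, 0 < a → ∀ᶠ β : ℝ in atTop, b β ^ 2 ≤ a * bareLambda ((L : ℝ) ^ 3 * β) :=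
  R54.not_hb_small_of_powScale_floor (L := L) (c := c₀ * g * A) (p := r) (by positivity) hr
    (frozenProfile_offDiag_floor_eventually K Ω₀ ν Λ₀ Λ₁ Λν c s b M hg hA hon hcs hc hs hK hΛ hM hgap htilt hcfl hOD)

/-- **…and for `r > 1/6` the same floor is affordable**: `∀ a > 0, ∀ᶠ β, (C·powScale r β)² ≤ a·λ_b(L³β)` (R50T).  Lane A's window `1/6 < s < 1/5` is on this side:
the frozen-profile floor costs nothing there, it only says the hOD rate cannot be `o(β^{-s})`. [folklore] -/
theorem firstOrder_floor_affordable {C r : ℝ} (hC : 0 ≤ C) (hr : 1 / 6 < r) :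
    ∀ a : ℝ, 0 < a → ∀ᶠ β : ℝ in atTop, (C * powScale r β) ^ 2 ≤ a * bareLambda ((L : ℝ) ^ 3 * β) := by
  intro a ha
  obtain ⟨β0, h⟩ := R50T.polylog_window_affordable (L := L) (s := r) (A := C) (ε := 16 * a) (θ := 1) 0 hr hC (by linarith) one_pos
  filter_upwards [eventually_ge_atTop β0] with β hβ
  obtain ⟨b, hb, hb2⟩ := h β hβ
  have hb' : C * powScale r β ≤ b := by simpa using hb
  have h0 : 0 ≤ C * powScale r β := mul_nonneg hC (powScale_pos _ _).le
  calc (C * powScale r β) ^ 2 ≤ b ^ 2 := pow_le_pow_left₀ h0 hb' 2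
    _ ≤ 16 * a * 1 * bareLambda ((L : ℝ) ^ 3 * β) / 16 := hb2
    _ = a * bareLambda ((L : ℝ) ^ 3 * β) := by ring

end Ledger

end Summit.QuantumFields.YangMills.Theorems.TwistedTraceScaling.Negative.R58

end
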